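import Summits.ValiantsHypothesis.ValiantsHypothesis.Theorems.DivisionGapShadowBirkhoffHeightThurston

/-!
# Thurston's height dictionary, II: `stub_heightPolytrope` of the line `polytrope-kr-planar-dimers`

Support file for item `stmt-ValiantsHypothesis-5069` (route `DivisionGap`, crux `ShadowBirkhoff`): the
registered stub `stub_heightPolytrope` — every planar shadow of the height functions of the `2m × 2m`
board (the integer points of the Lipschitz polytrope `LIP_m`, `heightPoints m`) is a planar shadow of the
domino polytope of the board (`dominoPoints (2m)`), with the same number of vertices.

Construction (finite and topology-free).  `DivisionGapShadowBirkhoffHeightThurston` provides the map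
`heightToDomino : heights → tilings` (`heightToDomino_mem`).  Here we build the converse LINEAR map
`dominoToHeight m : ℝ^{V × V} →ₗ ℝ^{lattice points}` (Thurston's height of a tiling, reduced by the brick
tiling): the value at the lattice point `(a, b)` is the row sum `∑_{a' < a} eps x a' b` of the horizontal
increments forced by `HorizOK` from the crossings of the row-`b` lattice edges.  For a tiling `x`:
* `HorizOK` holds by construction, rows `0`, `2m` and column `0` vanish trivially;
* the "one domino side per cell" identity (`cell_tile`) is rewritten as discrete exactness
  `eps (a', b+1) − eps (a', b) = eta (a'+1, b) − eta (a', b)` (`eps_exact`), whose telescoped form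
  `g(a, b+1) − g(a, b) = eta (a, b)` (`gN_succ_sub`) is `VertOK`, and — since `eta (2m, ·) = 0` — also gives
  the vanishing on column `2m` by induction on the row (no colour-counting needed);
so `dominoToHeight m x ∈ heightPoints m` (`dominoToHeight_mem`).  Conversely
`dominoToHeight m (heightToDomino g) = g` for every `g` vanishing on the boundary (a telescoping row sum,
`dominoToHeight_heightToDomino`).  Hence with `L := Λ ∘ₗ dominoToHeight m` the two shadows are the same
finite set, `Λ '' heightPoints m = L '' dominoPoints (2m)`, and the vertex counts agree.

References: W. P. Thurston, *Conway's tiling groups*, Amer. Math. Monthly 97 (1990) 757–773; J. Propp,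
*Lattice structure for orientations of graphs*, arXiv:math/0209005, Thm 2.
-/

set_option linter.dupNamespace false

noncomputable section

namespace Summit.ValiantsHypothesis.ValiantsHypothesis.Theorems.DivisionGapShadowBirkhoff

variable {m : ℕ}

/-- The domino space `ℝ^{V × V}`, `V = Fin 2m × Fin 2m`, of the board (local shorthand). -/
local notation "Dsp" => (Fin (2 * m) × Fin (2 * m)) × (Fin (2 * m) × Fin (2 * m)) → ℝ

/-! ## Crossing indicators and increments of a point of the domino space -/

/-- Total extension of a point of the domino space `ℝ^{V × V}` to `ℕ⁴` (zero outside the board). -/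
def xN (x : Dsp) (i j i' j' : ℕ) : ℝ :=
  if h : i < 2 * m ∧ j < 2 * m ∧ i' < 2 * m ∧ j' < 2 * m then
    x ((⟨i, h.1⟩, ⟨j, h.2.1⟩), (⟨i', h.2.2.1⟩, ⟨j', h.2.2.2⟩)) else 0

/-- Crossing indicator of the horizontal lattice edge of row `b` at column `a` (between the cell `(a, b-1)`
below and the cell `(a, b)` above); `0` on row `0`. -/
def hCross (x : Dsp) : ℕ → ℕ → ℝ
  | _, 0 => 0
  | a, b + 1 => xN x a b a (b + 1)

/-- Crossing indicator of the vertical lattice edge of column `a` at row `b` (between the cell `(a-1, b)`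
on the left and the cell `(a, b)` on the right); `0` on column `0`. -/
def vCross (x : Dsp) : ℕ → ℕ → ℝ
  | 0, _ => 0
  | a + 1, b => xN x a b (a + 1) b

/-- Horizontal increment `g(a+1, b) − g(a, b)` of the height forced by `HorizOK`. -/
def eps (x : Dsp) (a b : ℕ) : ℝ :=
  (if (a + b) % 2 = 0 then -1 else 1) * hCross x a b

/-- Vertical increment `g(a, b+1) − g(a, b)` of the height forced by `VertOK`. -/
def eta (x : Dsp) (a b : ℕ) : ℝ :=
  if (a + b) % 2 = 1 then (if a % 2 = 1 then (1 : ℝ) else 0) - vCross x a b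
  else vCross x a b - (if a % 2 = 1 then (1 : ℝ) else 0)

/-- Thurston's (reduced) height of `x` at the lattice point `(a, b)`: the row sum of the horizontal
increments from the left boundary. -/
def gN (x : Dsp) (a b : ℕ) : ℝ :=
  ∑ a' ∈ Finset.range a, eps x a' b

/-- `eps` is linear in `x` (additive and homogeneous). -/
theorem eps_linear (x y : Dsp) (r : ℝ) (a b : ℕ) :
    eps (x + y) a b = eps x a b + eps y a b ∧ eps (r • x) a b = r * eps x a b := by
  unfold eps
  cases b with
  | zero => constructor <;> simp [hCross]
  | succ b =>
    simp only [hCross, xN]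
    split_ifs <;> constructor <;>
      (try simp only [Pi.add_apply, Pi.smul_apply, smul_eq_mul]) <;> ring

/-- THURSTON'S DICTIONARY, converse direction, as a LINEAR map `ℝ^{V × V} → ℝ^{lattice points}`:
`x ↦ ((a, b) ↦ ∑_{a' < a} eps x a' b)`. -/
def dominoToHeight (m : ℕ) :
    ((Fin (2 * m) × Fin (2 * m)) × (Fin (2 * m) × Fin (2 * m)) → ℝ) →ₗ[ℝ] (LatticePt m → ℝ) where
  toFun x p := gN x p.1 p.2
  map_add' x y := by
    funext p
    simp only [gN, Pi.add_apply, ← Finset.sum_add_distrib]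
    exact Finset.sum_congr rfl fun a' _ => (eps_linear x y 0 a' _).1
  map_smul' r x := by
    funext p
    simp only [gN, RingHom.id_apply, Pi.smul_apply, smul_eq_mul, Finset.mul_sum]
    exact Finset.sum_congr rfl fun a' _ => (eps_linear x x r a' _).2

/-- Pointwise formula for `dominoToHeight`. -/
theorem dominoToHeight_apply (x : Dsp) (p : LatticePt m) : dominoToHeight m x p = gN x p.1 p.2 := rfl

/-- `hCross` vanishes on the top row `2m` (the edge has no cell above it). -/
theorem hCross_top (x : Dsp) (a : ℕ) : hCross x a (2 * m) = 0 := by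
  cases h : 2 * m with
  | zero => rfl
  | succ k =>
    show xN x a k a (k + 1) = 0
    unfold xN
    rw [dif_neg (by omega)]

/-- `vCross` vanishes on the right column `2m`. -/
theorem vCross_top (x : Dsp) (b : ℕ) : vCross x (2 * m) b = 0 := by
  cases h : 2 * m with
  | zero => rfl
  | succ k =>
    show xN x k b (k + 1) b = 0
    unfold xN
    rw [dif_neg (by omega)]

/-- `eta` vanishes on column `0`. -/
theorem eta_zero_col (x : Dsp) (b : ℕ) : eta x 0 b = 0 := by
  unfold eta
  split_ifs <;> first | (exfalso; omega) | simp [vCross]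

/-- `eta` vanishes on column `2m`. -/
theorem eta_col_top (x : Dsp) (b : ℕ) : eta x (2 * m) b = 0 := by
  unfold eta
  rw [vCross_top]
  split_ifs <;> first | (exfalso; omega) | simp

/-- The height vanishes on column `0`. -/
theorem gN_zero_col (x : Dsp) (b : ℕ) : gN x 0 b = 0 := by
  simp [gN]

/-- The height vanishes on row `0`. -/
theorem gN_row_zero (x : Dsp) (a : ℕ) : gN x a 0 = 0 :=
  Finset.sum_eq_zero fun a' _ => by simp [eps, hCross]

/-- The height vanishes on row `2m`. -/
theorem gN_row_top (x : Dsp) (a : ℕ) : gN x a (2 * m) = 0 :=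
  Finset.sum_eq_zero fun a' _ => by simp [eps, hCross_top]

/-- Horizontal increments of the height are `eps` (by definition). -/
theorem gN_succ (x : Dsp) (a b : ℕ) : gN x (a + 1) b = gN x a b + eps x a b := by
  unfold gN
  rw [Finset.sum_range_succ]

/-- The algebra of discrete exactness: if the four sides `R, L, U, D` of the cell `(i, j)` sum to `1`, the
horizontal increments across its bottom and top edges and the vertical increments along its left and right
edges commute. -/
theorem exact_alg (i j : ℕ) {R L U D : ℝ} (hcell : R + L + D + U = 1) :
    (if (i + (j + 1)) % 2 = 0 then -1 else 1) * U - (if (i + j) % 2 = 0 then -1 else 1) * D =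
      (if (i + 1 + j) % 2 = 1 then (if (i + 1) % 2 = 1 then (1 : ℝ) else 0) - R
        else R - (if (i + 1) % 2 = 1 then (1 : ℝ) else 0)) -
      (if (i + j) % 2 = 1 then (if i % 2 = 1 then (1 : ℝ) else 0) - L
        else L - (if i % 2 = 1 then (1 : ℝ) else 0)) := by
  split_ifs <;> first | (exfalso; omega) | linarith

/-! ## Tilings -/

/-- Indicator of the graph of `f` (the point of `dominoPoints` attached to the involution `f`). -/
def tileInd (f : Fin (2 * m) × Fin (2 * m) → Fin (2 * m) × Fin (2 * m)) : Dsp :=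
  fun e => if f e.1 = e.2 then 1 else 0

/-- Entries of `xN (tileInd f)` from a cell of the board, in coordinates. -/
theorem xN_tile (f : Fin (2 * m) × Fin (2 * m) → Fin (2 * m) × Fin (2 * m)) {i j : ℕ}
    (hi : i < 2 * m) (hj : j < 2 * m) (p q : ℕ) :
    xN (tileInd f) i j p q =
      if ((f (⟨i, hi⟩, ⟨j, hj⟩)).1 : ℕ) = p ∧ ((f (⟨i, hi⟩, ⟨j, hj⟩)).2 : ℕ) = q then 1 else 0 := by
  unfold xN tileInd
  by_cases hp : p < 2 * m
  · by_cases hq : q < 2 * m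
    · rw [dif_pos ⟨hi, hj, hp, hq⟩]
      simp only [Prod.ext_iff, Fin.ext_iff]
    · rw [dif_neg (by omega), if_neg]
      rintro ⟨-, h⟩
      have := (f (⟨i, hi⟩, ⟨j, hj⟩)).2.2
      omega
  · rw [dif_neg (by omega), if_neg]
    rintro ⟨h, -⟩
    have := (f (⟨i, hi⟩, ⟨j, hj⟩)).1.2
    omega

/-- Entries of `xN (tileInd f)` are `0` or `1`. -/
theorem xN_tile_01 (f : Fin (2 * m) × Fin (2 * m) → Fin (2 * m) × Fin (2 * m)) (i j p q : ℕ) :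
    xN (tileInd f) i j p q = 0 ∨ xN (tileInd f) i j p q = 1 := by
  unfold xN tileInd
  split_ifs <;> simp

/-- `hCross (tileInd f)` is `0` or `1`. -/
theorem hCross_01 (f : Fin (2 * m) × Fin (2 * m) → Fin (2 * m) × Fin (2 * m)) (a b : ℕ) :
    hCross (tileInd f) a b = 0 ∨ hCross (tileInd f) a b = 1 := by
  cases b with
  | zero => exact Or.inl rfl
  | succ b => exact xN_tile_01 f a b a (b + 1)

/-- `vCross (tileInd f)` is `0` or `1`. -/
theorem vCross_01 (f : Fin (2 * m) × Fin (2 * m) → Fin (2 * m) × Fin (2 * m)) (a b : ℕ) :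
    vCross (tileInd f) a b = 0 ∨ vCross (tileInd f) a b = 1 := by
  cases a with
  | zero => exact Or.inl rfl
  | succ a => exact xN_tile_01 f a b (a + 1) b

/-- The increments `eps (tileInd f)` are integers. -/
theorem eps_int (f : Fin (2 * m) × Fin (2 * m) → Fin (2 * m) × Fin (2 * m)) (a b : ℕ) :
    ∃ z : ℤ, eps (tileInd f) a b = z := by
  unfold eps
  rcases hCross_01 f a b with h | h <;> rw [h] <;> split_ifs
  exacts [⟨0, by simp⟩, ⟨0, by simp⟩, ⟨-1, by simp⟩, ⟨1, by simp⟩]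

/-- The height `gN (tileInd f)` is integer-valued. -/
theorem gN_int (f : Fin (2 * m) × Fin (2 * m) → Fin (2 * m) × Fin (2 * m)) (a b : ℕ) :
    ∃ z : ℤ, gN (tileInd f) a b = z := by
  induction a with
  | zero => exact ⟨0, by simp [gN]⟩
  | succ a ih =>
    obtain ⟨z, hz⟩ := ih
    obtain ⟨z', hz'⟩ := eps_int f a b
    exact ⟨z + z', by rw [gN_succ, hz, hz']; push_cast; ring⟩

section Tiling

variable {f : Fin (2 * m) × Fin (2 * m) → Fin (2 * m) × Fin (2 * m)}

/-- For an involution `f` the matrix `xN (tileInd f)` is symmetric. -/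
theorem xN_tile_symm (hf : ∀ v, f (f v) = v ∧ f v ≠ v ∧ IsGridAdjacent v (f v)) (i j p q : ℕ) :
    xN (tileInd f) i j p q = xN (tileInd f) p q i j := by
  unfold xN tileInd
  by_cases h : i < 2 * m ∧ j < 2 * m ∧ p < 2 * m ∧ q < 2 * m
  · rw [dif_pos h, dif_pos ⟨h.2.2.1, h.2.2.2, h.1, h.2.1⟩]
    dsimp only
    by_cases h1 : f (⟨i, h.1⟩, ⟨j, h.2.1⟩) = (⟨p, h.2.2.1⟩, ⟨q, h.2.2.2⟩)
    · rw [if_pos h1, if_pos (by rw [← h1, (hf _).1])]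
    · rw [if_neg h1, if_neg (fun h2 => h1 (by rw [← h2, (hf _).1]))]
  · rw [dif_neg h, dif_neg (fun h' => h ⟨h'.2.2.1, h'.2.2.2, h'.1, h'.2.1⟩)]

/-- ONE DOMINO SIDE PER CELL: for a tiling, exactly one of the four sides of the cell `(i, j)` is
crossed (sides on the boundary of the board count `0`). -/
theorem cell_tile (hf : ∀ v, f (f v) = v ∧ f v ≠ v ∧ IsGridAdjacent v (f v)) {i j : ℕ}
    (hi : i < 2 * m) (hj : j < 2 * m) :
    vCross (tileInd f) (i + 1) j + vCross (tileInd f) i j + hCross (tileInd f) i j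
      + hCross (tileInd f) i (j + 1) = 1 := by
  have hadj := (hf (⟨i, hi⟩, ⟨j, hj⟩)).2.2
  unfold IsGridAdjacent at hadj
  simp only [Fin.ext_iff] at hadj
  have hL : vCross (tileInd f) i j = if 1 ≤ i then xN (tileInd f) i j (i - 1) j else 0 := by
    cases i with
    | zero => rfl
    | succ i =>
      rw [if_pos (by omega), Nat.add_sub_cancel]
      exact xN_tile_symm hf _ _ _ _
  have hD : hCross (tileInd f) i j = if 1 ≤ j then xN (tileInd f) i j i (j - 1) else 0 := by
    cases j with
    | zero => rfl
    | succ j =>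
      rw [if_pos (by omega), Nat.add_sub_cancel]
      exact xN_tile_symm hf _ _ _ _
  rw [hL, hD, show vCross (tileInd f) (i + 1) j = xN (tileInd f) i j (i + 1) j from rfl,
    show hCross (tileInd f) i (j + 1) = xN (tileInd f) i j i (j + 1) from rfl]
  simp only [xN_tile f hi hj]
  rcases hadj with h | h | h | h <;> split_ifs <;> first | omega | norm_num

/-- DISCRETE EXACTNESS on the cell `(i, j)` of a tiling:
`eps (i, j+1) − eps (i, j) = eta (i+1, j) − eta (i, j)`. -/
theorem eps_exact (hf : ∀ v, f (f v) = v ∧ f v ≠ v ∧ IsGridAdjacent v (f v)) {i j : ℕ}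
    (hi : i < 2 * m) (hj : j < 2 * m) :
    eps (tileInd f) i (j + 1) - eps (tileInd f) i j =
      eta (tileInd f) (i + 1) j - eta (tileInd f) i j := by
  unfold eps eta
  exact exact_alg i j (cell_tile hf hi hj)

/-- TELESCOPED EXACTNESS: the vertical increments of Thurston's height are `eta`,
`g(a, b+1) − g(a, b) = eta (a, b)` for `a ≤ 2m`, `b < 2m`. -/
theorem gN_succ_sub (hf : ∀ v, f (f v) = v ∧ f v ≠ v ∧ IsGridAdjacent v (f v)) {a b : ℕ}
    (ha : a ≤ 2 * m) (hb : b < 2 * m) :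
    gN (tileInd f) a (b + 1) - gN (tileInd f) a b = eta (tileInd f) a b := by
  unfold gN
  rw [← Finset.sum_sub_distrib]
  have key : ∀ a' ∈ Finset.range a, eps (tileInd f) a' (b + 1) - eps (tileInd f) a' b =
      eta (tileInd f) (a' + 1) b - eta (tileInd f) a' b := by
    intro a' ha'
    rw [Finset.mem_range] at ha'
    exact eps_exact hf (by omega) hb
  rw [Finset.sum_congr rfl key]
  refine (Finset.sum_range_sub (fun a' => eta (tileInd f) a' b) a).trans ?_
  show eta (tileInd f) a b - eta (tileInd f) 0 b = eta (tileInd f) a b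
  rw [eta_zero_col, sub_zero]

/-- The height of a tiling vanishes on the right column `2m` (rows `b ≤ 2m`). -/
theorem gN_col_top (hf : ∀ v, f (f v) = v ∧ f v ≠ v ∧ IsGridAdjacent v (f v)) :
    ∀ b, b ≤ 2 * m → gN (tileInd f) (2 * m) b = 0 := by
  intro b
  induction b with
  | zero =>
    intro
    exact gN_row_zero _ _
  | succ b ih =>
    intro hb
    have h := gN_succ_sub hf (a := 2 * m) le_rfl (b := b) (by omega)
    rw [ih (by omega), eta_col_top, sub_zero] at h
    exact h

/-- THURSTON'S DICTIONARY, second half: the height of a domino tiling is a height function. -/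
theorem dominoToHeight_mem {x : Dsp} (hx : x ∈ dominoPoints (2 * m)) :
    dominoToHeight m x ∈ heightPoints m := by
  obtain ⟨f, hf, rfl⟩ := hx
  change dominoToHeight m (tileInd f) ∈ heightPoints m
  refine ⟨fun p => gN_int f p.1 p.2, ?_, ?_, ?_⟩
  · rintro ⟨a, b⟩ hp
    show gN (tileInd f) a b = 0
    rcases hp with h | h | h | h
    · rw [show (a : ℕ) = 0 from h]
      exact gN_zero_col _ _
    · rw [show (a : ℕ) = 2 * m from h]
      exact gN_col_top hf b (by omega)
    · rw [show (b : ℕ) = 0 from h]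
      exact gN_row_zero _ _
    · rw [show (b : ℕ) = 2 * m from h]
      exact gN_row_top _ _
  · intro a b
    have key := gN_succ_sub hf (a := a) (b := b) (by omega) b.2
    simp only [VertOK, dominoToHeight_apply, Fin.val_succ, Fin.val_castSucc]
    rw [key]
    unfold eta
    rcases vCross_01 f a b with h | h <;> rw [h] <;> split_ifs <;> norm_num
  · intro a b
    simp only [HorizOK, dominoToHeight_apply, Fin.val_succ, Fin.val_castSucc]
    rw [gN_succ, add_sub_cancel_left]
    unfold eps
    rcases hCross_01 f a b with h | h <;> rw [h] <;> split_ifs <;> norm_num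

end Tiling

/-- LEFT INVERSE: the height of the tiling attached to `g` is `g` itself, for every `g` vanishing on the
boundary (a telescoping row sum). -/
theorem dominoToHeight_heightToDomino {g : LatticePt m → ℝ} (hg0 : ∀ p, IsBoundaryPt m p → g p = 0) :
    dominoToHeight m (heightToDomino g) = g := by
  funext ⟨a, b⟩
  rw [dominoToHeight_apply]
  dsimp only
  rcases Nat.eq_zero_or_pos (b : ℕ) with hb0 | hb0
  · rw [hg0 _ (Or.inr (Or.inr (Or.inl hb0))), hb0]
    exact gN_row_zero _ _
  rcases eq_or_lt_of_le (Nat.lt_succ_iff.mp b.2) with hb2 | hb2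
  · rw [hg0 _ (Or.inr (Or.inr (Or.inr hb2))), hb2]
    exact gN_row_top _ _
  obtain ⟨b₀, hb₀⟩ : ∃ b₀, (b : ℕ) = b₀ + 1 := ⟨b - 1, by omega⟩
  have key : ∀ a' ∈ Finset.range a, eps (heightToDomino g) a' b =
      extN g (a' + 1) b - extN g a' b := by
    intro a' ha'
    rw [Finset.mem_range] at ha'
    have ha'2 : a' < 2 * m := by omega
    rw [hb₀]
    unfold eps
    rw [show hCross (heightToDomino g) a' (b₀ + 1) = xN (heightToDomino g) a' b₀ a' (b₀ + 1) from rfl]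
    unfold xN
    rw [dif_pos ⟨ha'2, by omega, ha'2, by omega⟩]
    unfold heightToDomino XN
    dsimp only
    rw [if_neg (show ¬(a' + 1 = a' ∧ b₀ = b₀ + 1) by omega),
      if_neg (show ¬(a' + 1 = a' ∧ b₀ = b₀ + 1) by omega),
      if_pos (show a' = a' ∧ b₀ + 1 = b₀ + 1 from ⟨rfl, rfl⟩)]
    unfold hEdge
    split_ifs <;> ring
  unfold gN
  rw [Finset.sum_congr rfl key]
  refine (Finset.sum_range_sub (fun a' => extN g a' b) a).trans ?_
  show extN g a b - extN g 0 b = g (a, b)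
  rw [extN_col_zero hg0, sub_zero, ← apply_eq_extN]

/-- **`stub_heightPolytrope`** (registered stub of the line `polytrope-kr-planar-dimers`, crux
`DivisionGap.ShadowBirkhoff`): every planar shadow of the height functions of the `2m × 2m` board is a planar
shadow of its domino polytope with at least as many vertices — in fact the same shadow point set, via
Thurston's dictionary: `Λ '' heightPoints m = (Λ ∘ₗ dominoToHeight m) '' dominoPoints (2m)`. -/
theorem stub_heightPolytrope : ∀ (m : ℕ) (Λ : (LatticePt m → ℝ) →ₗ[ℝ] (Fin 2 → ℝ)),
    ∃ L : ((Fin (2 * m) × Fin (2 * m)) × (Fin (2 * m) × Fin (2 * m)) → ℝ) →ₗ[ℝ] (Fin 2 → ℝ),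
      heightShadowVertexCount Λ ≤ dominoShadowVertexCount L := by
  intro m Λ
  refine ⟨Λ ∘ₗ dominoToHeight m, le_of_eq ?_⟩
  have hset : Λ '' heightPoints m = (Λ ∘ₗ dominoToHeight m) '' dominoPoints (2 * m) := by
    ext y
    constructor
    · rintro ⟨g, hg, rfl⟩
      refine ⟨heightToDomino g, heightToDomino_mem hg, ?_⟩
      rw [LinearMap.comp_apply, dominoToHeight_heightToDomino hg.2.1]
    · rintro ⟨x, hx, rfl⟩
      exact ⟨dominoToHeight m x, dominoToHeight_mem hx, rfl⟩
  unfold heightShadowVertexCount dominoShadowVertexCount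
  rw [hset]

end Summit.ValiantsHypothesis.ValiantsHypothesis.Theorems.DivisionGapShadowBirkhoff

end
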